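import Summits.QuantumFields.YangMills.Theorems.UnitScaleTiltProp7CombTildRem2HMcomb2MemberT3
import Summits.QuantumFields.YangMills.Theorems.UnitScaleTiltProp7HDOfCombRowsT3
import HarnessLib

/-!
# `UnitScaleTiltProp7CombTildRem2HMcomb2EnvelopeT3` — M-4c: **`hMc₂` ⟸ {`hMc`, `hGj`} IN G3's OWN BINDER LETTERS** — the `∃ e₂ A₂ B₂ B₂′`-envelope of the H2-1(E) member chain
(route `UnitScaleTilt`, crux K1 «MinimiserStabilityRegPr» stmt-QuantumFields-19200; (β) rows of ✓p708782 G3 `Prop7HDOfCombRows.hD_of_hMcomb (hMc) (hMc₂) (hN2s)`; def-free, count-neutral,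
`--supports stmt-QuantumFields-19200 --as helper`).  Cell `ym3-torus` (HUMAN RULING D-0037, YM ladder rung R3 — YM₃ on T³ is a rung, not d = 4, not infinite volume, not a mass gap,
not Clay), width seat `ym3-torus-px17` (gen 5).

WHY.  M-4b ✓`Prop7CombTildRem2HMcomb2MemberT3.hMcomb₂_of_hMcomb_of_gap` gives, per member, px13 g6's `hMcomb₂` row from the comb level masses (`hMc`'s row) and the per-level
norm-gap rows (G_j), with constants closed in `(L, ε₀)` and LINEAR in the currencies.  G3's displayed binders are ENVELOPES (`∀ L B₁′, ∃ constants, ∀ member data under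
`regFibrePr`∕criticality∕`In19`∕`AvgCondPrint`∕`IsLandauPrint`, ∀ levels, row`).  This file lifts M-4b to that shape: from the `hMc` envelope (TYPE of ★routeR-w6's F-8c-final
`hMcomb_holds`) and an envelope `hGj` for (G_j) in the SAME letters (its supplier: the F-lane's covariant-gradient rows; norm gap ≤ covariant gradient), it proves G3's `hMc₂` binder
VERBATIM — so the EX display can trade `hMc₂` for `hGj` (★★OWNER∕EX-namer business; this file is the theorem that licenses it).  The member bookkeeping: `ε₀ := (12B₁′+1)·e`
(lit ✓`regPr_mono` on `regFibrePr`'s second clause, ✓`mem_regFibrePr_iff`), `δ := 2B₁′e ≤ ε₀∕6`, `nMax19 < 2B₁′e` (✓`nMax19_lt_iff` on `In19`), `10⁸L⁵ε₀ ≤ 1` from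
`e ≤ e₂ ≤ ((12B₁′+1)·10⁸L⁵)⁻¹`, the one-step maps `T` as a lambda (`hT := rfl`) and the propagators from ✓H-4 `exists_propagator`; the constants become L-ONLY by `E ≤ 3∕2`
(M-4b-0 `exp_window_le`) and `a² ≤ a ≤ ((L^{K−n})²)⁻¹` (`a = ε₀((L^{K−n})²)⁻¹`, `ε₀ ≤ 1`).

WHAT IS PROVED (ns `…Theorems.Prop7CombTildRem2HMcomb2EnvelopeT3`; sorry-free):
* `slot_algebra` — the real-arithmetic regrouping of M-4b's closed constants into `A₂·M·(Lˡ)⁻¹ + (B₂·(K+DIV) + B₂′·ℓ⁻²·M)·Lˡ` with `E ≤ 3∕2`;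
* ★★★`hMc₂_of_hMc_of_hGj (hMc : ⟨G3's `hMc` binder⟩) (hGj : ⟨same prefix; `∀ j < K − n, NORMGAPcell_j(Ỹ_j) ≤ (Bg₁·(K+DIV) + Bg₂·((L^{K−n})²)⁻¹·Σ‖X‖²)·Lʲ`⟩) : ⟨G3's `hMc₂` binder⟩`.
HONEST FRAMING.  A wrapper (M); `hMc` and `hGj` are DISPLAYED OPEN route-internal rows; nothing of `hMcomb`∕(G_j)∕(β)∕hPA2∕hcoS∕E′∕EX∕the crux is proved; rung R3, not Clay; the YM mass gap is NOT proved.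
References: T. Bałaban, CMP 98 (1985) 17–51 [Balaban1985Averaging] ((65)–(69) p.29, Prop. 3 (113)–(126) pp.34–36); CMP 102 (1985) 277–309 [Balaban1985Variational] ((2), (6) p.278,
(19) p.281, Prop. 7 p.299); CMP 99 (1985) 75–102 [Balaban1985RegularSpaces] (Prop. 7 (1.139)–(1.145) p.100); CMP 109 (1987) 249–301 [Balaban1987RG1] ((0.4) p.253).
-/

set_option autoImplicit false

noncomputable section

open scoped BigOperators Matrix.Norms.L2Operator

namespace Summit.QuantumFields.YangMills.Theorems.Prop7CombTildRem2HMcomb2EnvelopeT3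

open Finset NormedSpace
open Literature.MathematicalPhysics.QuantumFieldTheory.Balaban1983to89
open Literature.MathematicalPhysics.QuantumFieldTheory.Balaban1983to89.T3ContinuumYM3Torus
open Literature.MathematicalPhysics.QuantumFieldTheory.Balaban1983to89.T3UnitLawDensityEML (ℰp)
open Literature.MathematicalPhysics.QuantumFieldTheory.Balaban1983to89.T3ConstrainedMinimiser (fibre)
open Literature.MathematicalPhysics.QuantumFieldTheory.Balaban1983to89.T3PrintedRegularMinimiser
open Literature.MathematicalPhysics.QuantumFieldTheory.Balaban1983to89.T3PrintedMinimiserExistence (regPr_mono)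
open Literature.MathematicalPhysics.QuantumFieldTheory.Balaban1983to89.T3RegularMinimiser
open Literature.MathematicalPhysics.QuantumFieldTheory.Balaban1983to89.T3Thm1Carrier
open T4Continuum T4ReflectionCone BlockAveraging AveragingRT ExpMeanLog BlockAveragingEMLLinearised BlockAveragingEMLLinearisedBackground BlockAveragingEMLProp2
open T3SectALandauChart (emb15 eta eta_pos bgUnits In19)
open B7Prop1Explicit renaming Site → LSite
open B7Prop1Explicit (seg boxVec gammaWord Wcx Xavg expUnit)
open B7Prop2Explicit (avgIter)
open B7Eq92Concrete (tildIter)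
open B7Prop3GeneralRotated (tsum)
open B9Eq39Adjoint (divB)
open B9TorusCalculus (torusT)
open B10Eq27TorusAxialLog (pull transl unitsField toUField)
open Summit.QuantumFields.YangMills.Theorems.Prop7SPrint (basePt RestrictedPrint AvgCondPrint IsLandauPrint)
open Summit.QuantumFields.YangMills.Theorems.Prop7TPrint (expHermField nMax19 nMax19_lt_iff)
open Summit.QuantumFields.YangMills.Theorems.Prop7LinearTowerDuhamel (exists_propagator)
open Summit.QuantumFields.YangMills.Theorems.Prop7CombTildRem2HMcomb2MemberRowsT3 (exp_window_le windows_of_ten8)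
open Summit.QuantumFields.YangMills.Theorems.Prop7CombTildRem2HMcomb2MemberT3 (hMcomb₂_of_hMcomb_of_gap)

/-! ## §1 The regrouping of M-4b's constants into G3's three slots -/

/-- **SLOT ALGEBRA**: with `E ≤ 3∕2`, `a² ≤ a ≤ q`, all data nonnegative and `L ≥ 2`, M-4b's closed bound regroups as `A₂·M·Ll⁻¹ + (B₂·(K+DIV) + B₂′·q·M)·Ll` with L-ONLY `A₂ B₂ B₂′`.
[cite: Balaban1985Variational, Prop. 7 p.299] -/
theorem slot_algebra {E Cs L A B B' Bg₁ Bg₂ M KW DV q a Ll : ℝ}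
    (hE0 : 0 ≤ E) (hE : E ≤ 3 / 2) (hL : 2 ≤ L) (hCs : 0 ≤ Cs) (hA : 0 ≤ A) (hB : 0 ≤ B) (hB' : 0 ≤ B') (hBg₁ : 0 ≤ Bg₁) (hBg₂ : 0 ≤ Bg₂)
    (hM : 0 ≤ M) (hKW : 0 ≤ KW) (hDV : 0 ≤ DV) (hq : 0 ≤ q) (haq : a ≤ q) (haa : a ^ 2 ≤ q) (hLl : 0 < Ll) :
    E * ((4374 * Cs + 729 * (1 : ℝ)) + (1728 * Cs + 288 * (1 : ℝ)) * L * (2 * L + 9) ^ 3 * 1 / (L - 1)) * (A * M * (L ^ 2 / (L - 1)) + M)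
          * Ll⁻¹
        + (E * ((4374 * Cs + 729 * (1 : ℝ)) + (1728 * Cs + 288 * (1 : ℝ)) * L * (2 * L + 9) ^ 3 * 1 / (L - 1)) * (B * (KW + DV) + B' * q * M) * (L ^ 2 / (L ^ 3 - 1))
            + E * ((1728 * Cs + 288 * (1 : ℝ)) * L * (2 * L + 9) ^ 3) * (13068 * (L + 4) ^ 2) * L ^ 2 *
                ((Bg₁ * (KW + DV) + Bg₂ * q * M) / (L - 1) ^ 2 + (2 * (2 * KW + 32 * 3 * a ^ 2 * M) + DV + 2 * 3 * a * (2 * M))))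
          * Ll
      ≤ (3 / 2 * ((4374 * Cs + 729) + (1728 * Cs + 288) * L * (2 * L + 9) ^ 3 / (L - 1)) * (A * (L ^ 2 / (L - 1)) + 1)) * M * Ll⁻¹
        + ((3 / 2 * (((4374 * Cs + 729) + (1728 * Cs + 288) * L * (2 * L + 9) ^ 3 / (L - 1)) * B * (L ^ 2 / (L ^ 3 - 1))
              + ((1728 * Cs + 288) * L * (2 * L + 9) ^ 3) * (13068 * (L + 4) ^ 2) * L ^ 2 * (Bg₁ / (L - 1) ^ 2 + 4))) * (KW + DV)
          + (3 / 2 * (((4374 * Cs + 729) + (1728 * Cs + 288) * L * (2 * L + 9) ^ 3 / (L - 1)) * B' * (L ^ 2 / (L ^ 3 - 1))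
              + ((1728 * Cs + 288) * L * (2 * L + 9) ^ 3) * (13068 * (L + 4) ^ 2) * L ^ 2 * (Bg₂ / (L - 1) ^ 2 + 204))) * q * M) * Ll := by
  -- letters
  set c : ℝ := (4374 * Cs + 729) + (1728 * Cs + 288) * L * (2 * L + 9) ^ 3 / (L - 1) with hc
  set c' : ℝ := ((1728 * Cs + 288) * L * (2 * L + 9) ^ 3) * (13068 * (L + 4) ^ 2) * L ^ 2 with hc'
  set r₁ : ℝ := L ^ 2 / (L - 1) with hr₁
  set r₂ : ℝ := L ^ 2 / (L ^ 3 - 1) with hr₂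
  have hL1 : 0 < L - 1 := by linarith
  have hL3 : 0 < L ^ 3 - 1 := by
    have h8 : (2 : ℝ) ^ 3 ≤ L ^ 3 := pow_le_pow_left₀ (by norm_num) hL 3
    norm_num at h8; linarith
  have hc0 : 0 ≤ c := by rw [hc]; positivity
  have hc'0 : 0 ≤ c' := by rw [hc']; positivity
  have hr₁0 : 0 ≤ r₁ := by rw [hr₁]; positivity
  have hr₂0 : 0 ≤ r₂ := by rw [hr₂]; positivity
  have e1 : (4374 * Cs + 729 * (1 : ℝ)) + (1728 * Cs + 288 * (1 : ℝ)) * L * (2 * L + 9) ^ 3 * 1 / (L - 1) = c := by rw [hc]; ring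
  have e2 : (1728 * Cs + 288 * (1 : ℝ)) * L * (2 * L + 9) ^ 3 = (1728 * Cs + 288) * L * (2 * L + 9) ^ 3 := by ring
  rw [e1, e2]
  have hKD : 0 ≤ KW + DV := by positivity
  have hLl0 : 0 ≤ Ll := hLl.le
  have hLli : 0 ≤ Ll⁻¹ := by positivity
  -- the level-0 currency `G₀ ≤ 4·(K+DIV) + 204·q·M`
  have hG0 : 2 * (2 * KW + 32 * 3 * a ^ 2 * M) + DV + 2 * 3 * a * (2 * M) ≤ 4 * (KW + DV) + 204 * (q * M) := by
    nlinarith [mul_le_mul_of_nonneg_right haa hM, mul_le_mul_of_nonneg_right haq hM]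
  -- A-slot
  have hT1 : E * c * (A * M * r₁ + M) * Ll⁻¹ ≤ (3 / 2 * c * (A * r₁ + 1)) * M * Ll⁻¹ := by
    have h0 : 0 ≤ c * (A * r₁ + 1) * M * Ll⁻¹ := by positivity
    have e : E * c * (A * M * r₁ + M) * Ll⁻¹ = E * (c * (A * r₁ + 1) * M * Ll⁻¹) := by ring
    rw [e]
    calc E * (c * (A * r₁ + 1) * M * Ll⁻¹) ≤ 3 / 2 * (c * (A * r₁ + 1) * M * Ll⁻¹) := mul_le_mul_of_nonneg_right hE h0
      _ = (3 / 2 * c * (A * r₁ + 1)) * M * Ll⁻¹ := by ring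
  -- B-slots
  have hin : (Bg₁ * (KW + DV) + Bg₂ * q * M) / (L - 1) ^ 2 + (2 * (2 * KW + 32 * 3 * a ^ 2 * M) + DV + 2 * 3 * a * (2 * M))
      ≤ (Bg₁ / (L - 1) ^ 2 + 4) * (KW + DV) + (Bg₂ / (L - 1) ^ 2 + 204) * (q * M) := by
    have e : (Bg₁ * (KW + DV) + Bg₂ * q * M) / (L - 1) ^ 2 = Bg₁ / (L - 1) ^ 2 * (KW + DV) + Bg₂ / (L - 1) ^ 2 * (q * M) := by
      field_simp
    rw [e]; nlinarith [hG0]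
  have hT2 : (E * c * (B * (KW + DV) + B' * q * M) * r₂ + E * c' * ((Bg₁ * (KW + DV) + Bg₂ * q * M) / (L - 1) ^ 2
        + (2 * (2 * KW + 32 * 3 * a ^ 2 * M) + DV + 2 * 3 * a * (2 * M)))) * Ll
      ≤ ((3 / 2 * (c * B * r₂ + c' * (Bg₁ / (L - 1) ^ 2 + 4))) * (KW + DV) + (3 / 2 * (c * B' * r₂ + c' * (Bg₂ / (L - 1) ^ 2 + 204))) * q * M) * Ll := by
    refine mul_le_mul_of_nonneg_right ?_ hLl0
    have hG'0 : 0 ≤ (Bg₁ / (L - 1) ^ 2 + 4) * (KW + DV) + (Bg₂ / (L - 1) ^ 2 + 204) * (q * M) := by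
      have : 0 ≤ Bg₁ / (L - 1) ^ 2 + 4 := by positivity
      have : 0 ≤ Bg₂ / (L - 1) ^ 2 + 204 := by positivity
      positivity
    have h1 : E * c' * ((Bg₁ * (KW + DV) + Bg₂ * q * M) / (L - 1) ^ 2 + (2 * (2 * KW + 32 * 3 * a ^ 2 * M) + DV + 2 * 3 * a * (2 * M)))
        ≤ E * c' * ((Bg₁ / (L - 1) ^ 2 + 4) * (KW + DV) + (Bg₂ / (L - 1) ^ 2 + 204) * (q * M)) := mul_le_mul_of_nonneg_left hin (by positivity)
    have hX0 : 0 ≤ c * (B * (KW + DV) + B' * q * M) * r₂ + c' * ((Bg₁ / (L - 1) ^ 2 + 4) * (KW + DV) + (Bg₂ / (L - 1) ^ 2 + 204) * (q * M)) := by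
      positivity
    have h2 := mul_le_mul_of_nonneg_right hE hX0
    have e3 : E * c * (B * (KW + DV) + B' * q * M) * r₂ + E * c' * ((Bg₁ / (L - 1) ^ 2 + 4) * (KW + DV) + (Bg₂ / (L - 1) ^ 2 + 204) * (q * M))
        = E * (c * (B * (KW + DV) + B' * q * M) * r₂ + c' * ((Bg₁ / (L - 1) ^ 2 + 4) * (KW + DV) + (Bg₂ / (L - 1) ^ 2 + 204) * (q * M))) := by ring
    have e4 : 3 / 2 * (c * (B * (KW + DV) + B' * q * M) * r₂ + c' * ((Bg₁ / (L - 1) ^ 2 + 4) * (KW + DV) + (Bg₂ / (L - 1) ^ 2 + 204) * (q * M)))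
        = (3 / 2 * (c * B * r₂ + c' * (Bg₁ / (L - 1) ^ 2 + 4))) * (KW + DV) + (3 / 2 * (c * B' * r₂ + c' * (Bg₂ / (L - 1) ^ 2 + 204))) * q * M := by ring
    linarith [h1, h2, e3, e4]
  have etot : E * c * (A * M * r₁ + M) * Ll⁻¹ + (E * c * (B * (KW + DV) + B' * q * M) * r₂ + E * c' * ((Bg₁ * (KW + DV) + Bg₂ * q * M) / (L - 1) ^ 2
        + (2 * (2 * KW + 32 * 3 * a ^ 2 * M) + DV + 2 * 3 * a * (2 * M)))) * Ll
      ≤ (3 / 2 * c * (A * r₁ + 1)) * M * Ll⁻¹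
        + ((3 / 2 * (c * B * r₂ + c' * (Bg₁ / (L - 1) ^ 2 + 4))) * (KW + DV) + (3 / 2 * (c * B' * r₂ + c' * (Bg₂ / (L - 1) ^ 2 + 204))) * q * M) * Ll :=
    add_le_add hT1 hT2
  linarith [etot]

/-! ## §2 ★★★ The envelope -/

-- hb: the member instantiation elaborates two ~3 kB binder texts (G3's `hMc`∕`hMc₂`) and one `simp only` on M-4b's closed bound; measured > 200k < 400k (README №24 (a) class).
set_option maxHeartbeats 400000 in
/-- ★★★ **`hMc₂` ⟸ {`hMc`, `hGj`} IN G3's BINDER LETTERS.**  From the comb level-mass envelope `hMc` (= G3 ✓p708782 `hD_of_hMcomb`'s first binder = the TYPE of F-8c-final `hMcomb_holds`)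
and the norm-gap envelope `hGj` ((G_j) in the same quantifier prefix and member hypotheses; conclusion `∀ j < K − n, NORMGAPcell_j(Ỹ_j) ≤ (Bg₁·(K_W(iX)+DIV_W(iX)) +
Bg₂·((L^{K−n})²)⁻¹·Σ‖X‖²)·Lʲ`), G3's second binder `hMc₂` follows, with `e₂ := min (min eC eG) ((12B₁′+1)·10⁸·L⁵)⁻¹` and L-only `A₂ B₂ B₂′` (M-4b ✓`hMcomb₂_of_hMcomb_of_gap` at
`ε₀ := (12B₁′+1)e`, `δ := 2B₁′e`, `T :=` the written-out one-step maps, `P` from ✓`exists_propagator`; `slot_algebra`).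
[cite: Balaban1985Variational, (2), (6) p.278, (19) p.281, Prop. 7 p.299; Balaban1985Averaging, (65)-(69) p.29, Prop. 3 (113)-(126) pp.34-36; Balaban1987RG1, (0.4) p.253] -/
theorem hMc₂_of_hMc_of_hGj
    (hMc : ∀ (L : ℕ), 1 < L → ∀ (B₁' : ℝ), 0 < B₁' → ∃ eC A B B' : ℝ, 0 < eC ∧ 0 ≤ A ∧ 0 ≤ B ∧ 0 ≤ B' ∧
      ∀ (F : T3Family), F.L = L → ∀ (n K : ℕ) (hnK : n < K) (e : ℝ) (V : GaugeField (F.P n) 0 (Matrix.specialUnitaryGroup (Fin 2) ℂ))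
        (W : GaugeField (F.P K) 0 (Matrix.specialUnitaryGroup (Fin 2) ℂ)) (X : PBond (F.P K) 0 → Matrix (Fin 2) (Fin 2) ℂ),
        0 < e → e ≤ eC → W ∈ regFibrePr F n K hnK.le e V →
        (∀ γ : ℝ → GaugeField (F.P K) 0 (Matrix.specialUnitaryGroup (Fin 2) ℂ), γ 0 = W → (∀ t, γ t ∈ fibre F ℰp n K hnK.le V) →
          (∀ b, DifferentiableAt ℝ (fun t => ((γ t b : Matrix.specialUnitaryGroup (Fin 2) ℂ) : Matrix (Fin 2) (Fin 2) ℂ)) 0) →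
            deriv (fun t => wilsonAction4 (γ t)) 0 = 0) →
        In19 F n K (2 * B₁' * e) W (expHermField X) X → AvgCondPrint F n K hnK.le V W X → IsLandauPrint F n K W X →
          ∀ l : ℕ, l < K - n →
            ∑ z : Site (F.P K) l, ∑ κ : Fin (F.P K).d,
              ‖((tildIter (F.P K).L (pull (bgUnits F K W) (basePt F n K)) (pull (fun b => expUnit (Complex.I • X b)) (basePt F n K)) l
              (fun μ => ((z μ).val : ℤ)) κ : (Matrix (Fin 2) (Fin 2) ℂ)ˣ) : Matrix (Fin 2) (Fin 2) ℂ) - 1‖ ^ 2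
              ≤ A * (∑ b : PBond (F.P K) 0, ‖X b‖ ^ 2) * ((F.L : ℝ) ^ l)⁻¹
                + (B * ((∑ p : Plaq (F.P K) 0, ‖((Complex.I • X ⟨p.src, p.μ⟩) + ((W ⟨p.src, p.μ⟩ : Matrix (Fin 2) (Fin 2) ℂ) * (Complex.I • X ⟨p.src.shift p.μ, p.ν⟩) * star (W ⟨p.src, p.μ⟩ : Matrix (Fin 2) (Fin 2) ℂ))
            - (((W ⟨p.src, p.μ⟩ * W ⟨p.src.shift p.μ, p.ν⟩ * (W ⟨p.src.shift p.ν, p.μ⟩)⁻¹ : Matrix.specialUnitaryGroup (Fin 2) ℂ) : Matrix (Fin 2) (Fin 2) ℂ) * (Complex.I • X ⟨p.src.shift p.ν, p.μ⟩) * star ((W ⟨p.src, p.μ⟩ * W ⟨p.src.shift p.μ, p.ν⟩ * (W ⟨p.src.shift p.ν, p.μ⟩)⁻¹ : Matrix.specialUnitaryGroup (Fin 2) ℂ) : Matrix (Fin 2) (Fin 2) ℂ))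
            - (((GaugeField.plaqHol W p : Matrix.specialUnitaryGroup (Fin 2) ℂ) : Matrix (Fin 2) (Fin 2) ℂ) * (Complex.I • X ⟨p.src, p.ν⟩) * star ((GaugeField.plaqHol W p : Matrix.specialUnitaryGroup (Fin 2) ℂ) : Matrix (Fin 2) (Fin 2) ℂ)))‖ ^ 2) + (∑ x : Site (F.P K) 0, ∑ j : Fin 2, ∑ k : Fin 2,
              ‖(divB (torusT (F.P K) 0) (fun κ z => unitsField (toUField W) ⟨z, κ⟩) (fun κ z => Complex.I • X ⟨z, κ⟩) x) j k‖ ^ 2))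
                  + B' * (((F.L : ℝ) ^ (K - n)) ^ 2)⁻¹ * (∑ b : PBond (F.P K) 0, ‖X b‖ ^ 2)) * (F.L : ℝ) ^ l)
    (hGj : ∀ (L : ℕ), 1 < L → ∀ (B₁' : ℝ), 0 < B₁' → ∃ eG Bg₁ Bg₂ : ℝ, 0 < eG ∧ 0 ≤ Bg₁ ∧ 0 ≤ Bg₂ ∧
      ∀ (F : T3Family), F.L = L → ∀ (n K : ℕ) (hnK : n < K) (e : ℝ) (V : GaugeField (F.P n) 0 (Matrix.specialUnitaryGroup (Fin 2) ℂ))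
        (W : GaugeField (F.P K) 0 (Matrix.specialUnitaryGroup (Fin 2) ℂ)) (X : PBond (F.P K) 0 → Matrix (Fin 2) (Fin 2) ℂ),
        0 < e → e ≤ eG → W ∈ regFibrePr F n K hnK.le e V →
        (∀ γ : ℝ → GaugeField (F.P K) 0 (Matrix.specialUnitaryGroup (Fin 2) ℂ), γ 0 = W → (∀ t, γ t ∈ fibre F ℰp n K hnK.le V) →
          (∀ b, DifferentiableAt ℝ (fun t => ((γ t b : Matrix.specialUnitaryGroup (Fin 2) ℂ) : Matrix (Fin 2) (Fin 2) ℂ)) 0) →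
            deriv (fun t => wilsonAction4 (γ t)) 0 = 0) →
        In19 F n K (2 * B₁' * e) W (expHermField X) X → AvgCondPrint F n K hnK.le V W X → IsLandauPrint F n K W X →
          ∀ j : ℕ, j < K - n →
            ∑ y : Fin (F.P K).d → Fin ((F.P K).sitesPerDir j), ∑ ν : Fin (F.P K).d, ∑ μ : Fin (F.P K).d,
              (‖((tildIter (F.P K).L (pull (bgUnits F K W) (basePt F n K)) (pull (fun b => expUnit (Complex.I • X b)) (basePt F n K)) (j) (boxVec ((F.P K).sitesPerDir j) y + B7Prop1Explicit.e μ) ν : (Matrix (Fin 2) (Fin 2) ℂ)ˣ) : Matrix (Fin 2) (Fin 2) ℂ) - 1‖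
                - ‖((tildIter (F.P K).L (pull (bgUnits F K W) (basePt F n K)) (pull (fun b => expUnit (Complex.I • X b)) (basePt F n K)) (j) (boxVec ((F.P K).sitesPerDir j) y) ν : (Matrix (Fin 2) (Fin 2) ℂ)ˣ) : Matrix (Fin 2) (Fin 2) ℂ) - 1‖) ^ 2
              ≤ (Bg₁ * ((∑ p : Plaq (F.P K) 0, ‖((Complex.I • X ⟨p.src, p.μ⟩)
          + ((W ⟨p.src, p.μ⟩ : Matrix (Fin 2) (Fin 2) ℂ) * (Complex.I • X ⟨p.src.shift p.μ, p.ν⟩) * star (W ⟨p.src, p.μ⟩ : Matrix (Fin 2) (Fin 2) ℂ))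
          - (((W ⟨p.src, p.μ⟩ * W ⟨p.src.shift p.μ, p.ν⟩ * (W ⟨p.src.shift p.ν, p.μ⟩)⁻¹ : Matrix.specialUnitaryGroup (Fin 2) ℂ) : Matrix (Fin 2) (Fin 2) ℂ)
              * (Complex.I • X ⟨p.src.shift p.ν, p.μ⟩)
              * star ((W ⟨p.src, p.μ⟩ * W ⟨p.src.shift p.μ, p.ν⟩ * (W ⟨p.src.shift p.ν, p.μ⟩)⁻¹ : Matrix.specialUnitaryGroup (Fin 2) ℂ) : Matrix (Fin 2) (Fin 2) ℂ))
          - (((GaugeField.plaqHol W p : Matrix.specialUnitaryGroup (Fin 2) ℂ) : Matrix (Fin 2) (Fin 2) ℂ) * (Complex.I • X ⟨p.src, p.ν⟩)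
              * star ((GaugeField.plaqHol W p : Matrix.specialUnitaryGroup (Fin 2) ℂ) : Matrix (Fin 2) (Fin 2) ℂ)))‖ ^ 2) + (∑ x : Site (F.P K) 0, ∑ j : Fin 2, ∑ k : Fin 2,
            ‖(divB (torusT (F.P K) 0) (fun κ z => unitsField (toUField W) ⟨z, κ⟩) (fun κ z => Complex.I • X ⟨z, κ⟩) x) j k‖ ^ 2)) + Bg₂ * (((F.L : ℝ) ^ (K - n)) ^ 2)⁻¹ * (∑ b : PBond (F.P K) 0, ‖X b‖ ^ 2)) * (F.L : ℝ) ^ j) :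
    ∀ (L : ℕ), 1 < L → ∀ (B₁' : ℝ), 0 < B₁' → ∃ e₂ A₂ B₂ B₂' : ℝ, 0 < e₂ ∧ 0 ≤ A₂ ∧ 0 ≤ B₂ ∧ 0 ≤ B₂' ∧
      ∀ (F : T3Family), F.L = L → ∀ (n K : ℕ) (hnK : n < K) (e : ℝ) (V : GaugeField (F.P n) 0 (Matrix.specialUnitaryGroup (Fin 2) ℂ))
        (W : GaugeField (F.P K) 0 (Matrix.specialUnitaryGroup (Fin 2) ℂ)) (X : PBond (F.P K) 0 → Matrix (Fin 2) (Fin 2) ℂ),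
        0 < e → e ≤ e₂ → W ∈ regFibrePr F n K hnK.le e V →
        (∀ γ : ℝ → GaugeField (F.P K) 0 (Matrix.specialUnitaryGroup (Fin 2) ℂ), γ 0 = W → (∀ t, γ t ∈ fibre F ℰp n K hnK.le V) →
          (∀ b, DifferentiableAt ℝ (fun t => ((γ t b : Matrix.specialUnitaryGroup (Fin 2) ℂ) : Matrix (Fin 2) (Fin 2) ℂ)) 0) →
            deriv (fun t => wilsonAction4 (γ t)) 0 = 0) →
        In19 F n K (2 * B₁' * e) W (expHermField X) X → AvgCondPrint F n K hnK.le V W X → IsLandauPrint F n K W X →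
          ∀ l : ℕ, l < K - n →
            ∑ z : Site (F.P K) l, ∑ κ : Fin (F.P K).d,
              ‖((tildIter (F.P K).L (pull (bgUnits F K W) (basePt F n K)) (pull (fun b => expUnit (Complex.I • X b)) (basePt F n K)) l
              (fun μ => ((z μ).val : ℤ)) κ : (Matrix (Fin 2) (Fin 2) ℂ)ˣ) : Matrix (Fin 2) (Fin 2) ℂ) - 1
            - (fderiv ℂ (fun A' : PBond (F.P K) 0 → Matrix (Fin 2) (Fin 2) ℂ =>
                ((tildIter (F.P K).L (pull (bgUnits F K W) (basePt F n K)) (pull (fun b => expUnit (A' b)) (basePt F n K)) l (fun μ => ((z μ).val : ℤ)) κ :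
                  (Matrix (Fin 2) (Fin 2) ℂ)ˣ) : Matrix (Fin 2) (Fin 2) ℂ)) 0) (fun b => Complex.I • X b)‖
              ≤ A₂ * (∑ b : PBond (F.P K) 0, ‖X b‖ ^ 2) * ((F.L : ℝ) ^ l)⁻¹
                + (B₂ * ((∑ p : Plaq (F.P K) 0, ‖((Complex.I • X ⟨p.src, p.μ⟩) + ((W ⟨p.src, p.μ⟩ : Matrix (Fin 2) (Fin 2) ℂ) * (Complex.I • X ⟨p.src.shift p.μ, p.ν⟩) * star (W ⟨p.src, p.μ⟩ : Matrix (Fin 2) (Fin 2) ℂ))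
            - (((W ⟨p.src, p.μ⟩ * W ⟨p.src.shift p.μ, p.ν⟩ * (W ⟨p.src.shift p.ν, p.μ⟩)⁻¹ : Matrix.specialUnitaryGroup (Fin 2) ℂ) : Matrix (Fin 2) (Fin 2) ℂ) * (Complex.I • X ⟨p.src.shift p.ν, p.μ⟩) * star ((W ⟨p.src, p.μ⟩ * W ⟨p.src.shift p.μ, p.ν⟩ * (W ⟨p.src.shift p.ν, p.μ⟩)⁻¹ : Matrix.specialUnitaryGroup (Fin 2) ℂ) : Matrix (Fin 2) (Fin 2) ℂ))
            - (((GaugeField.plaqHol W p : Matrix.specialUnitaryGroup (Fin 2) ℂ) : Matrix (Fin 2) (Fin 2) ℂ) * (Complex.I • X ⟨p.src, p.ν⟩) * star ((GaugeField.plaqHol W p : Matrix.specialUnitaryGroup (Fin 2) ℂ) : Matrix (Fin 2) (Fin 2) ℂ)))‖ ^ 2) + (∑ x : Site (F.P K) 0, ∑ j : Fin 2, ∑ k : Fin 2,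
              ‖(divB (torusT (F.P K) 0) (fun κ z => unitsField (toUField W) ⟨z, κ⟩) (fun κ z => Complex.I • X ⟨z, κ⟩) x) j k‖ ^ 2))
                  + B₂' * (((F.L : ℝ) ^ (K - n)) ^ 2)⁻¹ * (∑ b : PBond (F.P K) 0, ‖X b‖ ^ 2)) * (F.L : ℝ) ^ l := by
  intro L hL B₁' hB₁'
  obtain ⟨eC, A, B, B', heC, hA, hB, hB', hrowM⟩ := hMc L hL B₁' hB₁'
  obtain ⟨eG, Bg₁, Bg₂, heG, hBg₁, hBg₂, hrowG⟩ := hGj L hL B₁' hB₁'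
  have hLr : (2 : ℝ) ≤ (L : ℝ) := by exact_mod_cast hL
  have hB12 : (0 : ℝ) < 12 * B₁' + 1 := by positivity
  have hden : (0 : ℝ) < (12 * B₁' + 1) * (10 ^ 8 * (L : ℝ) ^ 5) := by positivity
  -- the constants (`Cs := 260·(8L)²`)
  refine ⟨min (min eC eG) (1 / ((12 * B₁' + 1) * (10 ^ 8 * (L : ℝ) ^ 5))),
    3 / 2 * ((4374 * (260 * ((2 * (3 : ℝ) + 2) * (L : ℝ)) ^ 2) + 729) + (1728 * (260 * ((2 * (3 : ℝ) + 2) * (L : ℝ)) ^ 2) + 288) * L * (2 * (L : ℝ) + 9) ^ 3 / ((L : ℝ) - 1))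
      * (A * ((L : ℝ) ^ 2 / ((L : ℝ) - 1)) + 1),
    3 / 2 * (((4374 * (260 * ((2 * (3 : ℝ) + 2) * (L : ℝ)) ^ 2) + 729) + (1728 * (260 * ((2 * (3 : ℝ) + 2) * (L : ℝ)) ^ 2) + 288) * L * (2 * (L : ℝ) + 9) ^ 3 / ((L : ℝ) - 1))
        * B * ((L : ℝ) ^ 2 / ((L : ℝ) ^ 3 - 1))
      + ((1728 * (260 * ((2 * (3 : ℝ) + 2) * (L : ℝ)) ^ 2) + 288) * L * (2 * (L : ℝ) + 9) ^ 3) * (13068 * ((L : ℝ) + 4) ^ 2) * (L : ℝ) ^ 2 * (Bg₁ / ((L : ℝ) - 1) ^ 2 + 4)),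
    3 / 2 * (((4374 * (260 * ((2 * (3 : ℝ) + 2) * (L : ℝ)) ^ 2) + 729) + (1728 * (260 * ((2 * (3 : ℝ) + 2) * (L : ℝ)) ^ 2) + 288) * L * (2 * (L : ℝ) + 9) ^ 3 / ((L : ℝ) - 1))
        * B' * ((L : ℝ) ^ 2 / ((L : ℝ) ^ 3 - 1))
      + ((1728 * (260 * ((2 * (3 : ℝ) + 2) * (L : ℝ)) ^ 2) + 288) * L * (2 * (L : ℝ) + 9) ^ 3) * (13068 * ((L : ℝ) + 4) ^ 2) * (L : ℝ) ^ 2 * (Bg₂ / ((L : ℝ) - 1) ^ 2 + 204)),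
    lt_min (lt_min heC heG) (by positivity), ?_, ?_, ?_, ?_⟩
  · have : (0 : ℝ) < (L : ℝ) - 1 := by linarith
    positivity
  · have : (0 : ℝ) < (L : ℝ) - 1 := by linarith
    have h8 : (2 : ℝ) ^ 3 ≤ (L : ℝ) ^ 3 := pow_le_pow_left₀ (by norm_num) hLr 3
    have : (0 : ℝ) < (L : ℝ) ^ 3 - 1 := by norm_num at h8; linarith
    positivity
  · have : (0 : ℝ) < (L : ℝ) - 1 := by linarith
    have h8 : (2 : ℝ) ^ 3 ≤ (L : ℝ) ^ 3 := pow_le_pow_left₀ (by norm_num) hLr 3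
    have : (0 : ℝ) < (L : ℝ) ^ 3 - 1 := by norm_num at h8; linarith
    positivity
  intro F hF n K hnK e V W X he heε hW hcrit hIn hAvg hLan l hl
  -- the radii
  have he1 : e ≤ eC := heε.trans ((min_le_left _ _).trans (min_le_left _ _))
  have he2 : e ≤ eG := heε.trans ((min_le_left _ _).trans (min_le_right _ _))
  have he3 : e ≤ 1 / ((12 * B₁' + 1) * (10 ^ 8 * (L : ℝ) ^ 5)) := heε.trans (min_le_right _ _)
  have hε₀ : 0 < (12 * B₁' + 1) * e := by positivity
  have hε : 10 ^ 8 * (F.L : ℝ) ^ 5 * ((12 * B₁' + 1) * e) ≤ 1 := by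
    rw [hF]
    have h1 := (le_div_iff₀ hden).1 he3
    have e1 : 10 ^ 8 * (L : ℝ) ^ 5 * ((12 * B₁' + 1) * e) = e * ((12 * B₁' + 1) * (10 ^ 8 * (L : ℝ) ^ 5)) := by ring
    rw [e1]; exact h1
  have heB : 0 ≤ B₁' * e := by positivity
  have hreg : RegPr F n K ((12 * B₁' + 1) * e) W :=
    regPr_mono F (by linarith only [heB] : e ≤ (12 * B₁' + 1) * e) ((mem_regFibrePr_iff F).1 hW).2
  have hδ : 2 * B₁' * e ≤ (12 * B₁' + 1) * e / 6 := by
    have e1 : (12 * B₁' + 1) * e / 6 = 2 * B₁' * e + e / 6 := by ring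
    rw [e1]; linarith only [he.le]
  have hX6 : nMax19 F n K W X < (12 * B₁' + 1) * e / 6 := lt_of_lt_of_le (nMax19_lt_iff.2 hIn.2.2) hδ
  -- the one-step maps and their propagators
  obtain ⟨P, hP0, hPs⟩ := exists_propagator (V := LSite (F.P K).d → Fin (F.P K).d → Matrix (Fin 2) (Fin 2) ℂ)
    (fun (k : ℕ) (f : LSite (F.P K).d → Fin (F.P K).d → Matrix (Fin 2) (Fin 2) ℂ) (z : LSite (F.P K).d) (κ : Fin (F.P K).d) =>
      letI : CStarAlgebra (Matrix (Fin 2) (Fin 2) ℂ) := B10Eq29TubeLine.cstarAlgebraMatrix 2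
      fderiv ℂ (eml : ((Fin (F.P K).d → Fin (F.P K).L) → Matrix (Fin 2) (Fin 2) ℂ) → Matrix (Fin 2) (Fin 2) ℂ)
              (fun r => ((Wcx (F.P K).L (avgIter (F.P K).L (pull (bgUnits F K W) (basePt F n K)) k) (((F.P K).L : ℤ) • z) κ (boxVec (F.P K).L r) : (Matrix (Fin 2) (Fin 2) ℂ)ˣ) : Matrix (Fin 2) (Fin 2) ℂ))
              (fun r => tsum (avgIter (F.P K).L (pull (bgUnits F K W) (basePt F n K)) k) f (((F.P K).L : ℤ) • z) (gammaWord (F.P K).L κ (boxVec (F.P K).L r) ++ seg κ (-((F.P K).L : ℤ)))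
                * ((Wcx (F.P K).L (avgIter (F.P K).L (pull (bgUnits F K W) (basePt F n K)) k) (((F.P K).L : ℤ) • z) κ (boxVec (F.P K).L r) : (Matrix (Fin 2) (Fin 2) ℂ)ˣ) : Matrix (Fin 2) (Fin 2) ℂ))
              * (((expUnit (Xavg (F.P K).L (avgIter (F.P K).L (pull (bgUnits F K W) (basePt F n K)) k) (((F.P K).L : ℤ) • z) κ))⁻¹ : (Matrix (Fin 2) (Fin 2) ℂ)ˣ) : Matrix (Fin 2) (Fin 2) ℂ)
            + ((expUnit (Xavg (F.P K).L (avgIter (F.P K).L (pull (bgUnits F K W) (basePt F n K)) k) (((F.P K).L : ℤ) • z) κ) : (Matrix (Fin 2) (Fin 2) ℂ)ˣ) : Matrix (Fin 2) (Fin 2) ℂ)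
                * tsum (avgIter (F.P K).L (pull (bgUnits F K W) (basePt F n K)) k) f (((F.P K).L : ℤ) • z) (seg κ ((F.P K).L : ℤ))
              * (((expUnit (Xavg (F.P K).L (avgIter (F.P K).L (pull (bgUnits F K W) (basePt F n K)) k) (((F.P K).L : ℤ) • z) κ))⁻¹ : (Matrix (Fin 2) (Fin 2) ℂ)ˣ) : Matrix (Fin 2) (Fin 2) ℂ))
  -- the rows at this member
  have hMcm := hrowM F hF n K hnK e V W X he he1 hW hcrit hIn hAvg hLan
  have hGm := hrowG F hF n K hnK e V W X he he2 hW hcrit hIn hAvg hLan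
  have hM0 : 0 ≤ (∑ b : PBond (F.P K) 0, ‖X b‖ ^ 2) := by positivity
  have hKD0 : 0 ≤ ((∑ p : Plaq (F.P K) 0, ‖((Complex.I • X ⟨p.src, p.μ⟩)
          + ((W ⟨p.src, p.μ⟩ : Matrix (Fin 2) (Fin 2) ℂ) * (Complex.I • X ⟨p.src.shift p.μ, p.ν⟩) * star (W ⟨p.src, p.μ⟩ : Matrix (Fin 2) (Fin 2) ℂ))
          - (((W ⟨p.src, p.μ⟩ * W ⟨p.src.shift p.μ, p.ν⟩ * (W ⟨p.src.shift p.ν, p.μ⟩)⁻¹ : Matrix.specialUnitaryGroup (Fin 2) ℂ) : Matrix (Fin 2) (Fin 2) ℂ)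
              * (Complex.I • X ⟨p.src.shift p.ν, p.μ⟩)
              * star ((W ⟨p.src, p.μ⟩ * W ⟨p.src.shift p.μ, p.ν⟩ * (W ⟨p.src.shift p.ν, p.μ⟩)⁻¹ : Matrix.specialUnitaryGroup (Fin 2) ℂ) : Matrix (Fin 2) (Fin 2) ℂ))
          - (((GaugeField.plaqHol W p : Matrix.specialUnitaryGroup (Fin 2) ℂ) : Matrix (Fin 2) (Fin 2) ℂ) * (Complex.I • X ⟨p.src, p.ν⟩)
              * star ((GaugeField.plaqHol W p : Matrix.specialUnitaryGroup (Fin 2) ℂ) : Matrix (Fin 2) (Fin 2) ℂ)))‖ ^ 2) + (∑ x : Site (F.P K) 0, ∑ j : Fin 2, ∑ k : Fin 2,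
            ‖(divB (torusT (F.P K) 0) (fun κ z => unitsField (toUField W) ⟨z, κ⟩) (fun κ z => Complex.I • X ⟨z, κ⟩) x) j k‖ ^ 2)) := by positivity
  have hq0 : 0 ≤ (((F.L : ℝ) ^ (K - n)) ^ 2)⁻¹ := by positivity
  have main := hMcomb₂_of_hMcomb_of_gap F hε₀ hε W hreg X hδ hIn hX6 _ (fun _ _ _ _ => rfl) P hP0 hPs
    (Am := A * (∑ b : PBond (F.P K) 0, ‖X b‖ ^ 2)) (Bm := B * ((∑ p : Plaq (F.P K) 0, ‖((Complex.I • X ⟨p.src, p.μ⟩)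
          + ((W ⟨p.src, p.μ⟩ : Matrix (Fin 2) (Fin 2) ℂ) * (Complex.I • X ⟨p.src.shift p.μ, p.ν⟩) * star (W ⟨p.src, p.μ⟩ : Matrix (Fin 2) (Fin 2) ℂ))
          - (((W ⟨p.src, p.μ⟩ * W ⟨p.src.shift p.μ, p.ν⟩ * (W ⟨p.src.shift p.ν, p.μ⟩)⁻¹ : Matrix.specialUnitaryGroup (Fin 2) ℂ) : Matrix (Fin 2) (Fin 2) ℂ)
              * (Complex.I • X ⟨p.src.shift p.ν, p.μ⟩)
              * star ((W ⟨p.src, p.μ⟩ * W ⟨p.src.shift p.μ, p.ν⟩ * (W ⟨p.src.shift p.ν, p.μ⟩)⁻¹ : Matrix.specialUnitaryGroup (Fin 2) ℂ) : Matrix (Fin 2) (Fin 2) ℂ))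
          - (((GaugeField.plaqHol W p : Matrix.specialUnitaryGroup (Fin 2) ℂ) : Matrix (Fin 2) (Fin 2) ℂ) * (Complex.I • X ⟨p.src, p.ν⟩)
              * star ((GaugeField.plaqHol W p : Matrix.specialUnitaryGroup (Fin 2) ℂ) : Matrix (Fin 2) (Fin 2) ℂ)))‖ ^ 2) + (∑ x : Site (F.P K) 0, ∑ j : Fin 2, ∑ k : Fin 2,
            ‖(divB (torusT (F.P K) 0) (fun κ z => unitsField (toUField W) ⟨z, κ⟩) (fun κ z => Complex.I • X ⟨z, κ⟩) x) j k‖ ^ 2)) + B' * (((F.L : ℝ) ^ (K - n)) ^ 2)⁻¹ * (∑ b : PBond (F.P K) 0, ‖X b‖ ^ 2)) (Bg := Bg₁ * ((∑ p : Plaq (F.P K) 0, ‖((Complex.I • X ⟨p.src, p.μ⟩)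
          + ((W ⟨p.src, p.μ⟩ : Matrix (Fin 2) (Fin 2) ℂ) * (Complex.I • X ⟨p.src.shift p.μ, p.ν⟩) * star (W ⟨p.src, p.μ⟩ : Matrix (Fin 2) (Fin 2) ℂ))
          - (((W ⟨p.src, p.μ⟩ * W ⟨p.src.shift p.μ, p.ν⟩ * (W ⟨p.src.shift p.ν, p.μ⟩)⁻¹ : Matrix.specialUnitaryGroup (Fin 2) ℂ) : Matrix (Fin 2) (Fin 2) ℂ)
              * (Complex.I • X ⟨p.src.shift p.ν, p.μ⟩)
              * star ((W ⟨p.src, p.μ⟩ * W ⟨p.src.shift p.μ, p.ν⟩ * (W ⟨p.src.shift p.ν, p.μ⟩)⁻¹ : Matrix.specialUnitaryGroup (Fin 2) ℂ) : Matrix (Fin 2) (Fin 2) ℂ))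
          - (((GaugeField.plaqHol W p : Matrix.specialUnitaryGroup (Fin 2) ℂ) : Matrix (Fin 2) (Fin 2) ℂ) * (Complex.I • X ⟨p.src, p.ν⟩)
              * star ((GaugeField.plaqHol W p : Matrix.specialUnitaryGroup (Fin 2) ℂ) : Matrix (Fin 2) (Fin 2) ℂ)))‖ ^ 2) + (∑ x : Site (F.P K) 0, ∑ j : Fin 2, ∑ k : Fin 2,
            ‖(divB (torusT (F.P K) 0) (fun κ z => unitsField (toUField W) ⟨z, κ⟩) (fun κ z => Complex.I • X ⟨z, κ⟩) x) j k‖ ^ 2)) + Bg₂ * (((F.L : ℝ) ^ (K - n)) ^ 2)⁻¹ * (∑ b : PBond (F.P K) 0, ‖X b‖ ^ 2))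
    (by positivity) (by positivity) (by positivity) hMcm hGm l hl
  -- the letters of the member: `d = 3`, `(F.P K).L = F.L`, `L = F.L`
  have hd3r : ((F.P K).d : ℝ) = 3 := by rw [T3Family.P_d]; norm_num
  have hLL : (((F.P K).L : ℕ) : ℝ) = (F.L : ℝ) := rfl
  simp only [hd3r, hLL] at main
  subst hF
  refine main.trans ?_
  -- the slot algebra
  have hε1 : (12 * B₁' + 1) * e ≤ 1 := by
    have hL1 : (1 : ℝ) ≤ (F.L : ℝ) ^ 5 := one_le_pow₀ (by exact_mod_cast F.hL.2.le)
    have h2 : (12 * B₁' + 1) * e ≤ 10 ^ 8 * (F.L : ℝ) ^ 5 * ((12 * B₁' + 1) * e) := by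
      have h3 : (1 : ℝ) ≤ 10 ^ 8 * (F.L : ℝ) ^ 5 := by linarith only [hL1]
      exact le_mul_of_one_le_left hε₀.le h3
    exact h2.trans hε
  have hq1 : (((F.L : ℝ) ^ (K - n)) ^ 2)⁻¹ ≤ 1 := Summit.QuantumFields.YangMills.Theorems.Prop7CombCellLevelZeroCurrencyT3.inv_ell_sq_le_one F n K
  have haq : (12 * B₁' + 1) * e * (((F.L : ℝ) ^ (K - n)) ^ 2)⁻¹ ≤ (((F.L : ℝ) ^ (K - n)) ^ 2)⁻¹ :=
    mul_le_of_le_one_left hq0 hε1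
  have haa : ((12 * B₁' + 1) * e * (((F.L : ℝ) ^ (K - n)) ^ 2)⁻¹) ^ 2 ≤ (((F.L : ℝ) ^ (K - n)) ^ 2)⁻¹ := by
    have h0 : 0 ≤ (12 * B₁' + 1) * e * (((F.L : ℝ) ^ (K - n)) ^ 2)⁻¹ := by positivity
    calc ((12 * B₁' + 1) * e * (((F.L : ℝ) ^ (K - n)) ^ 2)⁻¹) ^ 2
        = ((12 * B₁' + 1) * e * (((F.L : ℝ) ^ (K - n)) ^ 2)⁻¹) * ((12 * B₁' + 1) * e * (((F.L : ℝ) ^ (K - n)) ^ 2)⁻¹) := sq _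
      _ ≤ (((F.L : ℝ) ^ (K - n)) ^ 2)⁻¹ * 1 := mul_le_mul haq (haq.trans hq1) h0 hq0
      _ = (((F.L : ℝ) ^ (K - n)) ^ 2)⁻¹ := mul_one _
  have hCs0 : (0:ℝ) ≤ 260 * ((2 * (3 : ℝ) + 2) * (F.L : ℝ)) ^ 2 := by positivity
  have hKW0 : 0 ≤ (∑ p : Plaq (F.P K) 0, ‖((Complex.I • X ⟨p.src, p.μ⟩)
          + ((W ⟨p.src, p.μ⟩ : Matrix (Fin 2) (Fin 2) ℂ) * (Complex.I • X ⟨p.src.shift p.μ, p.ν⟩) * star (W ⟨p.src, p.μ⟩ : Matrix (Fin 2) (Fin 2) ℂ))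
          - (((W ⟨p.src, p.μ⟩ * W ⟨p.src.shift p.μ, p.ν⟩ * (W ⟨p.src.shift p.ν, p.μ⟩)⁻¹ : Matrix.specialUnitaryGroup (Fin 2) ℂ) : Matrix (Fin 2) (Fin 2) ℂ)
              * (Complex.I • X ⟨p.src.shift p.ν, p.μ⟩)
              * star ((W ⟨p.src, p.μ⟩ * W ⟨p.src.shift p.μ, p.ν⟩ * (W ⟨p.src.shift p.ν, p.μ⟩)⁻¹ : Matrix.specialUnitaryGroup (Fin 2) ℂ) : Matrix (Fin 2) (Fin 2) ℂ))
          - (((GaugeField.plaqHol W p : Matrix.specialUnitaryGroup (Fin 2) ℂ) : Matrix (Fin 2) (Fin 2) ℂ) * (Complex.I • X ⟨p.src, p.ν⟩)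
              * star ((GaugeField.plaqHol W p : Matrix.specialUnitaryGroup (Fin 2) ℂ) : Matrix (Fin 2) (Fin 2) ℂ)))‖ ^ 2) :=
    Finset.sum_nonneg fun _ _ => pow_nonneg (norm_nonneg _) 2
  have hDV0 : 0 ≤ (∑ x : Site (F.P K) 0, ∑ j : Fin 2, ∑ k : Fin 2,
            ‖(divB (torusT (F.P K) 0) (fun κ z => unitsField (toUField W) ⟨z, κ⟩) (fun κ z => Complex.I • X ⟨z, κ⟩) x) j k‖ ^ 2) :=
    Finset.sum_nonneg fun _ _ => Finset.sum_nonneg fun _ _ => Finset.sum_nonneg fun _ _ => pow_nonneg (norm_nonneg _) 2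
  have hLl : (0:ℝ) < (F.L : ℝ) ^ l := by positivity
  have key := slot_algebra (E := Real.exp (20321280 * (F.L : ℝ) ^ 5 * ((12 * B₁' + 1) * e))) (Cs := 260 * ((2 * (3 : ℝ) + 2) * (F.L : ℝ)) ^ 2)
    (L := (F.L : ℝ)) (A := A) (B := B) (B' := B') (Bg₁ := Bg₁) (Bg₂ := Bg₂) (M := (∑ b : PBond (F.P K) 0, ‖X b‖ ^ 2)) (KW := (∑ p : Plaq (F.P K) 0, ‖((Complex.I • X ⟨p.src, p.μ⟩)
          + ((W ⟨p.src, p.μ⟩ : Matrix (Fin 2) (Fin 2) ℂ) * (Complex.I • X ⟨p.src.shift p.μ, p.ν⟩) * star (W ⟨p.src, p.μ⟩ : Matrix (Fin 2) (Fin 2) ℂ))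
          - (((W ⟨p.src, p.μ⟩ * W ⟨p.src.shift p.μ, p.ν⟩ * (W ⟨p.src.shift p.ν, p.μ⟩)⁻¹ : Matrix.specialUnitaryGroup (Fin 2) ℂ) : Matrix (Fin 2) (Fin 2) ℂ)
              * (Complex.I • X ⟨p.src.shift p.ν, p.μ⟩)
              * star ((W ⟨p.src, p.μ⟩ * W ⟨p.src.shift p.μ, p.ν⟩ * (W ⟨p.src.shift p.ν, p.μ⟩)⁻¹ : Matrix.specialUnitaryGroup (Fin 2) ℂ) : Matrix (Fin 2) (Fin 2) ℂ))
          - (((GaugeField.plaqHol W p : Matrix.specialUnitaryGroup (Fin 2) ℂ) : Matrix (Fin 2) (Fin 2) ℂ) * (Complex.I • X ⟨p.src, p.ν⟩)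
              * star ((GaugeField.plaqHol W p : Matrix.specialUnitaryGroup (Fin 2) ℂ) : Matrix (Fin 2) (Fin 2) ℂ)))‖ ^ 2)) (DV := (∑ x : Site (F.P K) 0, ∑ j : Fin 2, ∑ k : Fin 2,
            ‖(divB (torusT (F.P K) 0) (fun κ z => unitsField (toUField W) ⟨z, κ⟩) (fun κ z => Complex.I • X ⟨z, κ⟩) x) j k‖ ^ 2))
    (q := (((F.L : ℝ) ^ (K - n)) ^ 2)⁻¹) (a := (12 * B₁' + 1) * e * (((F.L : ℝ) ^ (K - n)) ^ 2)⁻¹) (Ll := (F.L : ℝ) ^ l)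
    (Real.exp_pos _).le (exp_window_le F hε₀.le hε) hLr hCs0 hA hB hB' hBg₁ hBg₂ hM0 hKW0 hDV0 hq0 haq haa hLl
  exact key


end Summit.QuantumFields.YangMills.Theorems.Prop7CombTildRem2HMcomb2EnvelopeT3

end
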